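import Summits.QuantumFields.YangMills.Theorems.AllWindowsColdBoxBoxHighLineK3PrimeRowWilsonSextic
import Summits.QuantumFields.YangMills.Theorems.AllWindowsColdBoxBoxHighLineK3PrimeRowSumRows
import Summits.QuantumFields.YangMills.Theorems.AllWindowsColdBoxBoxHighLineWilsonPlaquetteTaylor
import Summits.QuantumFields.YangMills.Theorems.AllWindowsColdBoxBoxHighLinePlaquetteObsL2

/-!
# K3′ ROWS RD and RE in the per-row `hKk` currency — the two `P`-rows with one SUP slot
# (planner ym-idea-2 g19 load-levelling 2026-08-30T01:53:27Z «hRD + hRE → w5»; fcl-p3 g27's hK3 ROW-SUM `tiltCum3_cutSet_size_of_rows (…) (hRD) (hRE)`;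
#  ASSEMBLY-U5 §8, LINE-20 ⟨stmt-QuantumFields-24336⟩)

Width seat `ym-line-sfw-p2-w5` (prover-ym-line-sfw-p2-w5-g24-0).  In fcl-p3's row decomposition ✓`abs_tiltCum3_muSet_tiltU_le_rows` (letters: `μD` the restricted
Gaussian on a symmetric cut set `D ⊆ smallField H s`, `P a = β·Σ_{p∈PT} tripleForm (Tc p) (plaqVar_p a)` the cubic vertex, `Lz = linCurvSq H (plaq12At z)`,
`cz = chartPlaqCost H z 1 2`, `cᵒz = chartPlaqCostOdd H z 1 2`, `T₀` the local cubic Taylor tensor with `|cᵒ − tripleForm T₀ ∘ plaqVar| ≤ C₀·t⁵`):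
`RD = |κ₃ μD P 0 (cᵒx − tripleForm T₀ ∘ plaqVar_x) Ly + κ₃ μD P 0 Lx (cᵒy − …)|`, `RE = |κ₃ μD P 0 cᵒx (cy − Ly − cᵒy) + κ₃ μD P 0 (cx − Lx − cᵒx) cᵒy|`.
Both have ONE slot that is uniformly small on `D` (`C₀·s⁵`, resp. the even quartic Wilson remainder `C₇·s⁴` of ✓`wilsonPlaquetteTaylor` clause 1); at `t = 0`
the three slots of `κ₃` commute (`tiltCum3_zero_swap`), so w4 g30's GENERIC sup×sd lemma ✓`GaussRestrict.abs_tiltCum3_muSet_zero_le_sup_mul_sd` applies with the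
small slot as the tilt letter and the other two at their honest Gaussian second moments (`E₀P² ≤ C_T B²H⁴L³/β` ✓`tripleBond_gaussAvg_le`;
`E₀(L − E₀L)² ≤ C_V L²/β²` ✓`gaussAvg_centred_linCurvSq_sq_le`; `E₀(cᵒ)² ≤ C₁₂/β³` ✓`PlaqObsL2.gaussAvg_chartPlaqCostOdd_sq_le`):

* `tiltCum3_zero_swap` — `κ₃,₀(X,Y;U) = κ₃,₀(U,Y;X)`;
* ★ `abs_tiltCum3_muSet_supSlot_le` — `|κ₃ μD P 0 N G|, |κ₃ μD P 0 G N| ≤ 2ν·√(2E₀P²)·√(2E₀(G − g₀)²)` for `sup_D |N| ≤ ν`;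
* ★★ `rowBound_RD` — the hypothesis `hRD` of fcl-p3's row-sum VERBATIM: `q := 1`, `K β H := 2·C·|C₀|·B·H²·(1+log H)³·s⁵·β^{−3/2}`, `s = β^{(1/8−θ/4)−1/2}`;
  budget `β²H⁸·K ≍ H¹⁰L³s⁵β^{1/2}`: exponent row at `κ₃ = 1/8 − θ/4`: `10θ + 5κ₃ − 2 = 8.75θ − 1.375 < 0 ⟺ θ < 0.157` ✓ (all `θ < 1/10`);
* ★★ `rowBound_RE` — the hypothesis `hRE` VERBATIM: `q := 1`, `K β H := 2·C·C₇·B·H²·(1+log H)²·s⁴·β⁻¹^2`; budget `H¹⁰L²s⁴`: `10θ + 4κ₃ − 2 = 9θ − 1.5 < 0 ⟺ θ < 1/6` ✓.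

Tree only; no definitions; standard axioms.  HONEST LABEL: helper-grade U5 prep (two remainder rows of hK3′; the row-sum stays CONDITIONAL on hE1r/hRA/hRB/hRC); U5 ⟨24336⟩
UNSTAFFED/OPEN, ⟨24004⟩ OPEN, this seat's line crux ⟨22884⟩ OPEN; route AllWindowsColdBox DRAFT; no crux, rung or summit is proved; **the Yang–Mills mass gap is NOT
proved by this file; no summit is proved by a line.**
-/

set_option autoImplicit false

noncomputable section

open MeasureTheory Set
open Literature.Probability.LatticeModels (Site)
open Literature.MathematicalPhysics.QuantumLattice (ZdPlaquette plaquettesTouching)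
open Literature.MathematicalPhysics.QuantumFieldTheory.AxialGauge (boxEdges)
open Summit.QuantumFields.YangMills.Theorems.WeakCouplingRates (plaq12At)

namespace Summit.QuantumFields.YangMills.Theorems.AllWindowsColdBoxBoxHighLine

namespace K3RowSum

open AssemblyBudget ErrorBudget

variable {H : ℕ} {β : ℝ}

/-! ## §1 Slot symmetry and the generic sup-slot bound -/

/-- At `t = 0` the tilt slot and the first observable slot of `κ₃` commute: `κ₃,₀(X,Y;U) = κ₃,₀(U,Y;X)`. -/
theorem tiltCum3_zero_swap {Ω : Type*} [MeasurableSpace Ω] (μ : Measure Ω) (U X Y : Ω → ℝ) :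
    Tilt.tiltCum3 μ U 0 X Y = Tilt.tiltCum3 μ X 0 U Y := by
  rw [GaussRestrict.tiltCum3_zero_eq_triple μ U U X Y, GaussRestrict.tiltCum3_zero_eq_triple μ X U U Y]
  congr 1; funext ω; ring

/-- ★ **The generic SUP-slot row**: over a cut set `D ⊆ smallField H s` with `E₀[1 − 1_D] ≤ τ ≤ 1/2`, for the cubic vertex `P` (`|Tc| ≤ B`), a measurable `N` with
`sup_D |N| ≤ ν` and a measurable `G` bounded on `D` with `E₀(G − g₀)² ≤ A` (integrable):
`|κ₃ μD P 0 N G| ≤ 2ν·√(2·C_T·B²H⁴(1+log H)³/β)·√(2A)` and the same for `|κ₃ μD P 0 G N|`. -/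
theorem abs_tiltCum3_muSet_supSlot_le : ∃ CT : ℝ, 0 ≤ CT ∧ ∀ H : ℕ, 1 ≤ H → ∀ β : ℝ, 0 < β → ∀ B : ℝ,
    ∀ Tc : ZdPlaquette 4 → Fin 4 → Fin 4 → Fin 4 → ℝ, (∀ p i j k, |Tc p i j k| ≤ B) →
    ∀ s : ℝ, 0 ≤ s → ∀ D : Set (LandauFree H → E3), MeasurableSet D → D ⊆ smallField H s →
    ∀ τ : ℝ, gaussAvg β H (fun a => 1 - D.indicator (fun _ => (1 : ℝ)) a) ≤ τ → τ ≤ 1 / 2 →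
    ∀ N G : (LandauFree H → E3) → ℝ, Measurable N → Measurable G → ∀ ν BG g₀ A : ℝ, 0 ≤ ν → (∀ a ∈ D, |N a| ≤ ν) → (∀ a ∈ D, |G a| ≤ BG) →
    Integrable (fun a => (G a - g₀) ^ 2 * gaussWeight β H a) → gaussAvg β H (fun a => (G a - g₀) ^ 2) ≤ A →
    |Tilt.tiltCum3 ((((volume : Measure (LandauFree H → E3)).restrict D).withDensity fun a => ENNReal.ofReal (gaussWeight β H a)))
        (fun a => β * ∑ p ∈ plaquettesTouching (boxEdges 4 (2 * H + 1)), tripleForm (Tc p) (plaqVar H p.1 p.2.1.1 p.2.1.2 a)) 0 N G| ≤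
      2 * ν * (Real.sqrt (2 * (CT * B ^ 2 * (H : ℝ) ^ 4 * (1 + Real.log H) ^ 3 / β)) * Real.sqrt (2 * A)) ∧
    |Tilt.tiltCum3 ((((volume : Measure (LandauFree H → E3)).restrict D).withDensity fun a => ENNReal.ofReal (gaussWeight β H a)))
        (fun a => β * ∑ p ∈ plaquettesTouching (boxEdges 4 (2 * H + 1)), tripleForm (Tc p) (plaqVar H p.1 p.2.1.1 p.2.1.2 a)) 0 G N| ≤
      2 * ν * (Real.sqrt (2 * (CT * B ^ 2 * (H : ℝ) ^ 4 * (1 + Real.log H) ^ 3 / β)) * Real.sqrt (2 * A)) := by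
  obtain ⟨CTB₀, hTB⟩ := EdgeChartGaussian.tripleBond_gaussAvg_le
  refine ⟨max CTB₀ 0, le_max_right _ _, fun H hH β hβ B Tc hT s hs0 D hDm hDs τ hτ hτ2 N G mN mG ν BG g₀ A hν bN bG iG hA => ?_⟩
  classical
  set PT := plaquettesTouching (boxEdges 4 (2 * H + 1)) with hPT
  have hB0 : 0 ≤ B := (abs_nonneg _).trans (hT (((0 : Site 4), ⟨(0, 1), by decide⟩) : ZdPlaquette 4) 0 0 0)
  -- the cubic vertex: measurable, bounded on `D`, second moment
  have hcP := EdgeChartGaussian.polyCert_tripleFormSum H β PT Tc hT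
  have mP : Measurable (fun a : LandauFree H → E3 => β * ∑ p ∈ PT, tripleForm (Tc p) (plaqVar H p.1 p.2.1.1 p.2.1.2 a)) :=
    EdgeChartGaussian.measurable_of_polyCert hcP
  set BP : ℝ := β * PT.card * (6 * B * (4 * s) ^ 3) with hBP
  have hBP0 : 0 ≤ BP := by positivity
  have bP : ∀ a ∈ D, |β * ∑ p ∈ PT, tripleForm (Tc p) (plaqVar H p.1 p.2.1.1 p.2.1.2 a)| ≤ max BP BG := by
    intro a ha
    refine le_trans ?_ (le_max_left _ _)
    rw [abs_mul, abs_of_pos hβ]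
    have hterm : ∀ p ∈ PT, |tripleForm (Tc p) (plaqVar H p.1 p.2.1.1 p.2.1.2 a)| ≤ 6 * B * (4 * s) ^ 3 := by
      intro p _
      refine (EdgeChartGaussian.abs_tripleForm_le (Tc p) (hT p) _).trans ?_
      exact mul_le_mul_of_nonneg_left (pow_le_pow_left₀ (Finset.sum_nonneg fun i _ => norm_nonneg _)
        (TiltSup.sum_norm_plaqVar_le hs0 (hDs ha) p.1 p.2.1.1 p.2.1.2) 3) (by positivity)
    have hsum : |∑ p ∈ PT, tripleForm (Tc p) (plaqVar H p.1 p.2.1.1 p.2.1.2 a)| ≤ PT.card * (6 * B * (4 * s) ^ 3) := by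
      refine (Finset.abs_sum_le_sum_abs _ _).trans ((Finset.sum_le_sum hterm).trans (le_of_eq ?_))
      rw [Finset.sum_const, nsmul_eq_mul]
    calc β * |∑ p ∈ PT, tripleForm (Tc p) (plaqVar H p.1 p.2.1.1 p.2.1.2 a)| ≤ β * (PT.card * (6 * B * (4 * s) ^ 3)) :=
          mul_le_mul_of_nonneg_left hsum hβ.le
      _ = BP := by rw [hBP]; ring
  have bG' : ∀ a ∈ D, |G a| ≤ max BP BG := fun a ha => (bG a ha).trans (le_max_right _ _)
  have hmax0 : 0 ≤ max BP BG := le_max_of_le_left hBP0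
  -- the two Gaussian sizes behind the `1_D`-moments
  have hP2 : gaussAvg β H (fun a => D.indicator (fun _ => (1 : ℝ)) a *
      ((β * ∑ p ∈ PT, tripleForm (Tc p) (plaqVar H p.1 p.2.1.1 p.2.1.2 a)) - 0) ^ 2) ≤
      max CTB₀ 0 * B ^ 2 * (H : ℝ) ^ 4 * (1 + Real.log H) ^ 3 / β := by
    have iP : Integrable (fun a : LandauFree H → E3 =>
        ((β * ∑ p ∈ PT, tripleForm (Tc p) (plaqVar H p.1 p.2.1.1 p.2.1.2 a)) - 0) ^ 2 * gaussWeight β H a) :=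
      EdgeChartGaussian.integrable_polyCert_mul_gaussWeight H hβ
        (EdgeChartGaussian.polyCert_pow (EdgeChartGaussian.polyCert_sub hcP (EdgeChartGaussian.polyCert_const _ 3)) 2)
    refine (GaussRestrict.gaussAvg_indicator_mul_le hβ D (fun a => sq_nonneg _) iP).trans ?_
    simp only [sub_zero]
    refine (hTB H hH β hβ B Tc hT).trans ?_
    have e1 : CTB₀ * B ^ 2 * (H : ℝ) ^ 4 * (1 + Real.log H) ^ 3 / β = CTB₀ * (B ^ 2 * (H : ℝ) ^ 4 * (1 + Real.log H) ^ 3 / β) := by ring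
    have e2 : max CTB₀ 0 * B ^ 2 * (H : ℝ) ^ 4 * (1 + Real.log H) ^ 3 / β = max CTB₀ 0 * (B ^ 2 * (H : ℝ) ^ 4 * (1 + Real.log H) ^ 3 / β) := by ring
    rw [e1, e2]
    have hH1 : (1 : ℝ) ≤ H := by exact_mod_cast hH
    have hL0 : 0 ≤ 1 + Real.log (H : ℝ) := by have := Real.log_nonneg hH1; linarith
    exact mul_le_mul_of_nonneg_right (le_max_left _ _) (by positivity)
  have hG2 : gaussAvg β H (fun a => D.indicator (fun _ => (1 : ℝ)) a * (G a - g₀) ^ 2) ≤ A :=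
    (GaussRestrict.gaussAvg_indicator_mul_le hβ D (fun a => sq_nonneg _) iG).trans hA
  have hsq : Real.sqrt (2 * gaussAvg β H (fun a => D.indicator (fun _ => (1 : ℝ)) a *
        ((β * ∑ p ∈ PT, tripleForm (Tc p) (plaqVar H p.1 p.2.1.1 p.2.1.2 a)) - 0) ^ 2)) *
      Real.sqrt (2 * gaussAvg β H (fun a => D.indicator (fun _ => (1 : ℝ)) a * (G a - g₀) ^ 2)) ≤
      Real.sqrt (2 * (max CTB₀ 0 * B ^ 2 * (H : ℝ) ^ 4 * (1 + Real.log H) ^ 3 / β)) * Real.sqrt (2 * A) :=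
    mul_le_mul (Real.sqrt_le_sqrt (by linarith)) (Real.sqrt_le_sqrt (by linarith)) (Real.sqrt_nonneg _) (Real.sqrt_nonneg _)
  have h2ν : 0 ≤ 2 * ν := by linarith
  constructor
  · rw [tiltCum3_zero_swap]
    have h := GaussRestrict.abs_tiltCum3_muSet_zero_le_sup_mul_sd hβ hDm hτ hτ2 hmax0 hν mP mG mN bP bG' bN 0 g₀
    exact h.trans (mul_le_mul_of_nonneg_left hsq h2ν)
  · rw [EdgeChartGaussian.tiltCum3_comm, tiltCum3_zero_swap]
    have h := GaussRestrict.abs_tiltCum3_muSet_zero_le_sup_mul_sd hβ hDm hτ hτ2 hmax0 hν mP mG mN bP bG' bN 0 g₀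
    exact h.trans (mul_le_mul_of_nonneg_left hsq h2ν)

/-! ## §2 Row RD -/

/-- ★★ **Row RD of the hK3 ROW-SUM in the per-row `hKk` currency** (the hypothesis `hRD` of fcl-p3 g27's `tiltCum3_cutSet_size_of_rows`, verbatim):
`q := 1`, `K β H := 4√(2C_T)√(2C_V)·|C₀|·B·H²·(1+log H)³·s⁵·(β⁻¹·√β⁻¹)`, `s = β^{(1/8−θ/4)−1/2}`; budget `β²H⁸K ≍ H¹⁰L³s⁵β^{1/2}`, exponent row at `κ₃ = 1/8 − θ/4`:
`10θ + 5κ₃ − 2 = 8.75θ − 1.375 < 0 ⟺ θ < 0.157` — strict for every `θ < 1/10` (the `Tc`-record clause is not needed and is ignored). -/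
theorem rowBound_RD : ∀ θ : ℝ, 0 < θ → θ < 1 / 10 → ∀ B Cr : ℝ, ∀ Tc : ZdPlaquette 4 → Fin 4 → Fin 4 → Fin 4 → ℝ, (∀ p i j k, |Tc p i j k| ≤ B) →
      (∀ H : ℕ, 1 ≤ H → ∀ β : ℝ, 0 < β → ∀ s : ℝ, 0 ≤ s → ∀ a ∈ smallField H s,
        |cubicVertex β H a + β * ∑ p ∈ plaquettesTouching (boxEdges 4 (2 * H + 1)), tripleForm (Tc p) (plaqVar H p.1 p.2.1.1 p.2.1.2 a)| ≤
          Cr * β * (H : ℝ) ^ 4 * s ^ 5) →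
      ∀ B₀ C₀ : ℝ, ∀ T₀ : Fin 4 → Fin 4 → Fin 4 → ℝ, (∀ i j k, |T₀ i j k| ≤ B₀) →
      (∀ (H : ℕ) (x : Site 4) (t : ℝ) (a : LandauFree H → E3), 0 ≤ t → t ≤ 1 → (∀ i, ‖plaqVar H x 1 2 a i‖ ≤ t) →
        |chartPlaqCostOdd H x 1 2 a - tripleForm T₀ (plaqVar H x 1 2 a)| ≤ C₀ * t ^ 5) →
      ∃ q : ℝ, ∃ K : ℝ → ℕ → ℝ,
      (∃ β₀ : ℝ, 1 ≤ β₀ ∧ ∀ β : ℝ, β₀ ≤ β → ∀ H : ℕ, 1 ≤ H → β ^ θ ≤ (H : ℝ) → (H : ℝ) ≤ β ^ θ + 1 →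
        ∀ D : Set (LandauFree H → E3), MeasurableSet D → D ⊆ smallField H (β ^ ((1 / 8 - θ / 4) - 1 / 2)) → (∀ a, -a ∈ D ↔ a ∈ D) →
        gaussAvg β H (fun a => 1 - D.indicator (fun _ => (1 : ℝ)) a) ≤ β ^ (-q) →
        gaussAvg β H (fun a => 1 - D.indicator (fun _ => (1 : ℝ)) a) ≤ 1 / 2 → (∀ a ∈ D, |tiltU β H a| ≤ 2) → ∀ x y : Site 4,
        let μD : Measure (LandauFree H → E3) := ((volume : Measure (LandauFree H → E3)).restrict D).withDensity fun a => ENNReal.ofReal (gaussWeight β H a)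
        let P : (LandauFree H → E3) → ℝ := fun a => β * ∑ p ∈ plaquettesTouching (boxEdges 4 (2 * H + 1)), tripleForm (Tc p) (plaqVar H p.1 p.2.1.1 p.2.1.2 a)
        |Tilt.tiltCum3 μD P 0 (fun a => chartPlaqCostOdd H x 1 2 a - tripleForm T₀ (plaqVar H x 1 2 a)) (linCurvSq H (plaq12At y)) +
            Tilt.tiltCum3 μD P 0 (linCurvSq H (plaq12At x)) (fun a => chartPlaqCostOdd H y 1 2 a - tripleForm T₀ (plaqVar H y 1 2 a))| ≤ K β H) ∧
      (∀ ε : ℝ, 0 < ε → ∃ β₀ : ℝ, 1 ≤ β₀ ∧ ∀ β : ℝ, β₀ ≤ β → ∀ H : ℕ, 1 ≤ H → (H : ℝ) ≤ β ^ θ + 1 → β ^ 2 * (H : ℝ) ^ 8 * K β H ≤ ε) := by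
  intro θ hθ hθ' B Cr Tc hTc _ B₀ C₀ T₀ hT₀ h5
  obtain ⟨CT, hCT0, hcore⟩ := abs_tiltCum3_muSet_supSlot_le
  obtain ⟨CV, hCV0, hV⟩ := EdgeChartGaussian.gaussAvg_centred_linCurvSq_sq_le
  have hB0 : 0 ≤ B := (abs_nonneg _).trans (hTc (((0 : Site 4), ⟨(0, 1), by decide⟩) : ZdPlaquette 4) 0 0 0)
  refine ⟨1, fun β H => 4 * Real.sqrt (2 * CT) * Real.sqrt (2 * CV) * |C₀| * B * (H : ℝ) ^ 2 * (1 + Real.log H) ^ 3 *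
    (β ^ ((1 / 8 - θ / 4) - 1 / 2)) ^ 5 * (β⁻¹ * Real.sqrt β⁻¹), ⟨2, by norm_num, ?_⟩, ?_⟩
  · intro β hβ H hH _ _ D hDm hDs _ hco _ _ x y
    have hβ0 : 0 < β := by linarith
    have hH1 : (1 : ℝ) ≤ H := by exact_mod_cast hH
    have hL1 : 1 ≤ 1 + Real.log (H : ℝ) := by have := Real.log_nonneg hH1; linarith
    have hL0 : 0 ≤ 1 + Real.log (H : ℝ) := zero_le_one.trans hL1
    have hτ2 : β ^ (-(1 : ℝ)) ≤ 1 / 2 := by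
      rw [Real.rpow_neg_one]
      have h := inv_anti₀ (by norm_num : (0 : ℝ) < 2) hβ
      norm_num at h ⊢
      exact h
    set s : ℝ := β ^ ((1 / 8 - θ / 4) - 1 / 2) with hs
    have hs0 : 0 ≤ s := Real.rpow_nonneg hβ0.le _
    have hs1 : s ≤ 1 := Real.rpow_le_one_of_one_le_of_nonpos (by linarith) (by linarith)
    -- the quintic slot
    have mF : ∀ z : Site 4, Measurable fun a : LandauFree H → E3 => chartPlaqCostOdd H z 1 2 a - tripleForm T₀ (plaqVar H z 1 2 a) := fun z =>
      (EdgeChartGaussian.measurable_chartPlaqCostOdd H z 1 2).sub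
        (EdgeChartGaussian.measurable_of_polyCert (EdgeChartGaussian.polyCert_tripleForm z 1 2 T₀ hT₀))
    have bF : ∀ z : Site 4, ∀ a ∈ D, |chartPlaqCostOdd H z 1 2 a - tripleForm T₀ (plaqVar H z 1 2 a)| ≤ |C₀| * s ^ 5 := fun z a ha =>
      (h5 H z s a hs0 hs1 fun i => TiltSup.norm_plaqVar_le hs0 (hDs ha) z 1 2 i).trans
        (mul_le_mul_of_nonneg_right (le_abs_self C₀) (pow_nonneg hs0 5))
    have hν : 0 ≤ |C₀| * s ^ 5 := mul_nonneg (abs_nonneg _) (pow_nonneg hs0 5)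
    -- the quadratic slot
    have mG : ∀ z : Site 4, Measurable (linCurvSq H (plaq12At z)) := fun z => EdgeChartGaussian.measurable_linCurvSq H (plaq12At z)
    have bG : ∀ z : Site 4, ∀ a ∈ D, |linCurvSq H (plaq12At z) a| ≤ 16 * s ^ 2 := fun z a ha => by
      have h0 : 0 ≤ linCurvSq H (plaq12At z) a := Finset.sum_nonneg fun c _ => sq_nonneg _
      rw [abs_of_nonneg h0]; exact TiltSup.linCurvSq_le hs0 (hDs ha) z 1 2
    have iG : ∀ z : Site 4, Integrable fun a : LandauFree H → E3 =>
        (linCurvSq H (plaq12At z) a - gaussAvg β H (linCurvSq H (plaq12At z))) ^ 2 * gaussWeight β H a := fun z =>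
      EdgeChartGaussian.integrable_polyCert_mul_gaussWeight H hβ0 (EdgeChartGaussian.polyCert_pow
        (EdgeChartGaussian.polyCert_sub (EdgeChartGaussian.polyCert_linCurvSq H _) (EdgeChartGaussian.polyCert_const _ 2)) 2)
    have hA : ∀ z : Site 4, gaussAvg β H (fun a => (linCurvSq H (plaq12At z) a - gaussAvg β H (linCurvSq H (plaq12At z))) ^ 2) ≤
        CV * (1 + Real.log H) ^ 2 / β ^ 2 := fun z => hV H hH β hβ0 (plaq12At z)
    -- the two terms
    have h1 := (hcore H hH β hβ0 B Tc hTc s hs0 D hDm hDs _ hco hτ2 _ _ (mF x) (mG y) _ _ _ _ hν (bF x) (bG y) (iG y) (hA y)).1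
    have h2 := (hcore H hH β hβ0 B Tc hTc s hs0 D hDm hDs _ hco hτ2 _ _ (mF y) (mG x) _ _ _ _ hν (bF y) (bG x) (iG x) (hA x)).2
    -- the square roots in letters
    have hsP : Real.sqrt (2 * (CT * B ^ 2 * (H : ℝ) ^ 4 * (1 + Real.log H) ^ 3 / β)) ≤
        Real.sqrt (2 * CT) * B * (H : ℝ) ^ 2 * (1 + Real.log H) ^ 2 * Real.sqrt β⁻¹ := by
      have hK0 : 0 ≤ Real.sqrt (2 * CT) * B * (H : ℝ) ^ 2 * (1 + Real.log H) ^ 2 * Real.sqrt β⁻¹ := by positivity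
      refine (Real.sqrt_le_sqrt ?_).trans (le_of_eq (Real.sqrt_sq hK0))
      have e : (Real.sqrt (2 * CT) * B * (H : ℝ) ^ 2 * (1 + Real.log H) ^ 2 * Real.sqrt β⁻¹) ^ 2 =
          2 * CT * B ^ 2 * (H : ℝ) ^ 4 * (1 + Real.log H) ^ 4 * β⁻¹ := by
        rw [show (Real.sqrt (2 * CT) * B * (H : ℝ) ^ 2 * (1 + Real.log H) ^ 2 * Real.sqrt β⁻¹) ^ 2 =
            Real.sqrt (2 * CT) ^ 2 * (B ^ 2 * ((H : ℝ) ^ 2) ^ 2 * ((1 + Real.log H) ^ 2) ^ 2) * Real.sqrt β⁻¹ ^ 2 by ring,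
          Real.sq_sqrt (by positivity), Real.sq_sqrt (inv_nonneg.2 hβ0.le)]
        ring
      rw [e, div_eq_mul_inv]
      have hL34 : (1 + Real.log (H : ℝ)) ^ 3 ≤ (1 + Real.log (H : ℝ)) ^ 4 := pow_le_pow_right₀ hL1 (by norm_num)
      have hc : 0 ≤ 2 * CT * B ^ 2 * (H : ℝ) ^ 4 * β⁻¹ := by positivity
      nlinarith [mul_le_mul_of_nonneg_left hL34 hc]
    have hsL : Real.sqrt (2 * (CV * (1 + Real.log H) ^ 2 / β ^ 2)) ≤ Real.sqrt (2 * CV) * (1 + Real.log H) * β⁻¹ := by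
      have hK0 : 0 ≤ Real.sqrt (2 * CV) * (1 + Real.log H) * β⁻¹ := by positivity
      refine (Real.sqrt_le_sqrt (le_of_eq ?_)).trans (le_of_eq (Real.sqrt_sq hK0))
      rw [show (Real.sqrt (2 * CV) * (1 + Real.log H) * β⁻¹) ^ 2 = Real.sqrt (2 * CV) ^ 2 * (1 + Real.log H) ^ 2 * β⁻¹ ^ 2 by ring,
        Real.sq_sqrt (by positivity), div_eq_mul_inv, inv_pow]
      ring
    have hprod : Real.sqrt (2 * (CT * B ^ 2 * (H : ℝ) ^ 4 * (1 + Real.log H) ^ 3 / β)) * Real.sqrt (2 * (CV * (1 + Real.log H) ^ 2 / β ^ 2)) ≤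
        (Real.sqrt (2 * CT) * B * (H : ℝ) ^ 2 * (1 + Real.log H) ^ 2 * Real.sqrt β⁻¹) * (Real.sqrt (2 * CV) * (1 + Real.log H) * β⁻¹) :=
      mul_le_mul hsP hsL (Real.sqrt_nonneg _) (by positivity)
    have hM := mul_le_mul_of_nonneg_left hprod (by positivity : (0 : ℝ) ≤ 2 * (|C₀| * s ^ 5))
    have e : 2 * (2 * (|C₀| * s ^ 5) * ((Real.sqrt (2 * CT) * B * (H : ℝ) ^ 2 * (1 + Real.log H) ^ 2 * Real.sqrt β⁻¹) *
        (Real.sqrt (2 * CV) * (1 + Real.log H) * β⁻¹))) =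
        4 * Real.sqrt (2 * CT) * Real.sqrt (2 * CV) * |C₀| * B * (H : ℝ) ^ 2 * (1 + Real.log H) ^ 3 * s ^ 5 * (β⁻¹ * Real.sqrt β⁻¹) := by ring
    refine (abs_add_le _ _).trans ?_
    beta_reduce
    rw [← hs, ← e]
    linarith [h1, h2, hM]
  · intro ε hε
    have hcond : ((10 : ℕ) : ℝ) * θ + 1 / 2 < ((5 : ℕ) : ℝ) * (1 / 2 - (1 / 8 - θ / 4)) := by push_cast; linarith
    obtain ⟨β₀, hβ₀, h⟩ := budget_monomial (a := 1 / 2) (k := 10) (j := 5) (κ₃ := 1 / 8 - θ / 4) hθ.le hcond hε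
      (4 * Real.sqrt (2 * CT) * Real.sqrt (2 * CV) * |C₀| * B) 3
    refine ⟨β₀, hβ₀, fun β hβ H hH hHu => ?_⟩
    have hβ0 : 0 < β := by linarith
    have e := h β hβ H hH hHu
    have hb : β ^ 2 * (β⁻¹ * Real.sqrt β⁻¹) = β ^ (1 / 2 : ℝ) := by
      have hb2 : (β : ℝ) ^ 2 = β ^ (2 : ℝ) := by rw [← Real.rpow_natCast]; norm_num
      rw [Real.sqrt_eq_rpow, ← Real.rpow_neg_one, ← Real.rpow_mul hβ0.le, hb2, ← Real.rpow_add hβ0, ← Real.rpow_add hβ0]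
      norm_num
    have hid : β ^ 2 * (H : ℝ) ^ 8 * (4 * Real.sqrt (2 * CT) * Real.sqrt (2 * CV) * |C₀| * B * (H : ℝ) ^ 2 * (1 + Real.log H) ^ 3 *
        (β ^ ((1 / 8 - θ / 4) - 1 / 2)) ^ 5 * (β⁻¹ * Real.sqrt β⁻¹)) =
        4 * Real.sqrt (2 * CT) * Real.sqrt (2 * CV) * |C₀| * B * (H : ℝ) ^ 10 * (1 + Real.log H) ^ 3 *
          (β ^ (1 / 8 - θ / 4 - 1 / 2)) ^ 5 * β ^ (1 / 2 : ℝ) := by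
      rw [← hb]; ring
    rw [hid]
    exact e

/-! ## §3 Row RE -/

/-- ★★ **Row RE of the hK3 ROW-SUM in the per-row `hKk` currency** (the hypothesis `hRE` of fcl-p3 g27's `tiltCum3_cutSet_size_of_rows`, verbatim): the even
quartic Wilson remainder `W_z = c_z − L_z − cᵒ_z` has `sup_D |W_z| ≤ C₇·s⁴` (✓`wilsonPlaquetteTaylor`, clause 1, with ✓`WilsonSandwich.linCurvSq_eq_norm_sq`); `q := 1`,
`K β H := 4√(2C_T)√(2C₁₂)·C₇·B·H²·(1+log H)²·s⁴·β⁻¹^2`; budget `β²H⁸K ≍ H¹⁰L²s⁴`, exponent row at `κ₃ = 1/8 − θ/4`: `10θ + 4κ₃ − 2 = 9θ − 3/2 < 0 ⟺ θ < 1/6` —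
strict for every `θ < 1/10` (the record clauses on `Tc`, `T₀` are not needed and are ignored). -/
theorem rowBound_RE : ∀ θ : ℝ, 0 < θ → θ < 1 / 10 → ∀ B Cr : ℝ, ∀ Tc : ZdPlaquette 4 → Fin 4 → Fin 4 → Fin 4 → ℝ, (∀ p i j k, |Tc p i j k| ≤ B) →
      (∀ H : ℕ, 1 ≤ H → ∀ β : ℝ, 0 < β → ∀ s : ℝ, 0 ≤ s → ∀ a ∈ smallField H s,
        |cubicVertex β H a + β * ∑ p ∈ plaquettesTouching (boxEdges 4 (2 * H + 1)), tripleForm (Tc p) (plaqVar H p.1 p.2.1.1 p.2.1.2 a)| ≤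
          Cr * β * (H : ℝ) ^ 4 * s ^ 5) →
      ∀ B₀ C₀ : ℝ, ∀ T₀ : Fin 4 → Fin 4 → Fin 4 → ℝ, (∀ i j k, |T₀ i j k| ≤ B₀) →
      (∀ (H : ℕ) (x : Site 4) (t : ℝ) (a : LandauFree H → E3), 0 ≤ t → t ≤ 1 → (∀ i, ‖plaqVar H x 1 2 a i‖ ≤ t) →
        |chartPlaqCostOdd H x 1 2 a - tripleForm T₀ (plaqVar H x 1 2 a)| ≤ C₀ * t ^ 5) →
      ∃ q : ℝ, ∃ K : ℝ → ℕ → ℝ,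
      (∃ β₀ : ℝ, 1 ≤ β₀ ∧ ∀ β : ℝ, β₀ ≤ β → ∀ H : ℕ, 1 ≤ H → β ^ θ ≤ (H : ℝ) → (H : ℝ) ≤ β ^ θ + 1 →
        ∀ D : Set (LandauFree H → E3), MeasurableSet D → D ⊆ smallField H (β ^ ((1 / 8 - θ / 4) - 1 / 2)) → (∀ a, -a ∈ D ↔ a ∈ D) →
        gaussAvg β H (fun a => 1 - D.indicator (fun _ => (1 : ℝ)) a) ≤ β ^ (-q) →
        gaussAvg β H (fun a => 1 - D.indicator (fun _ => (1 : ℝ)) a) ≤ 1 / 2 → (∀ a ∈ D, |tiltU β H a| ≤ 2) → ∀ x y : Site 4,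
        let μD : Measure (LandauFree H → E3) := ((volume : Measure (LandauFree H → E3)).restrict D).withDensity fun a => ENNReal.ofReal (gaussWeight β H a)
        let P : (LandauFree H → E3) → ℝ := fun a => β * ∑ p ∈ plaquettesTouching (boxEdges 4 (2 * H + 1)), tripleForm (Tc p) (plaqVar H p.1 p.2.1.1 p.2.1.2 a)
        |Tilt.tiltCum3 μD P 0 (chartPlaqCostOdd H x 1 2) (fun a => chartPlaqCost H y 1 2 a - linCurvSq H (plaq12At y) a - chartPlaqCostOdd H y 1 2 a) +
            Tilt.tiltCum3 μD P 0 (fun a => chartPlaqCost H x 1 2 a - linCurvSq H (plaq12At x) a - chartPlaqCostOdd H x 1 2 a) (chartPlaqCostOdd H y 1 2)| ≤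
          K β H) ∧
      (∀ ε : ℝ, 0 < ε → ∃ β₀ : ℝ, 1 ≤ β₀ ∧ ∀ β : ℝ, β₀ ≤ β → ∀ H : ℕ, 1 ≤ H → (H : ℝ) ≤ β ^ θ + 1 → β ^ 2 * (H : ℝ) ^ 8 * K β H ≤ ε) := by
  intro θ hθ hθ' B Cr Tc hTc _ B₀ C₀ T₀ _ _
  obtain ⟨CT, hCT0, hcore⟩ := abs_tiltCum3_muSet_supSlot_le
  obtain ⟨C₇, h7⟩ := wilsonPlaquetteTaylor
  obtain ⟨T7, hT7, h7c⟩ := h7 1 2 (by decide)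
  have hC₇ : 0 ≤ C₇ := (abs_nonneg _).trans (hT7 0 0 0)
  have hB0 : 0 ≤ B := (abs_nonneg _).trans (hTc (((0 : Site 4), ⟨(0, 1), by decide⟩) : ZdPlaquette 4) 0 0 0)
  set C₁₂ : ℝ := 2888 * (60 * 1036 ^ 2 + 81 * (60 * 1036 ^ 2) ^ 2) with hC₁₂
  have hC₁₂0 : 0 ≤ C₁₂ := by rw [hC₁₂]; norm_num
  refine ⟨1, fun β H => 4 * Real.sqrt (2 * CT) * Real.sqrt (2 * C₁₂) * C₇ * B * (H : ℝ) ^ 2 * (1 + Real.log H) ^ 2 *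
    (β ^ ((1 / 8 - θ / 4) - 1 / 2)) ^ 4 * β⁻¹ ^ 2, ⟨2, by norm_num, ?_⟩, ?_⟩
  · intro β hβ H hH _ _ D hDm hDs _ hco _ _ x y
    have hβ0 : 0 < β := by linarith
    have hH1 : (1 : ℝ) ≤ H := by exact_mod_cast hH
    have hL1 : 1 ≤ 1 + Real.log (H : ℝ) := by have := Real.log_nonneg hH1; linarith
    have hL0 : 0 ≤ 1 + Real.log (H : ℝ) := zero_le_one.trans hL1
    have hτ2 : β ^ (-(1 : ℝ)) ≤ 1 / 2 := by
      rw [Real.rpow_neg_one]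
      have h := inv_anti₀ (by norm_num : (0 : ℝ) < 2) hβ
      norm_num at h ⊢
      exact h
    set s : ℝ := β ^ ((1 / 8 - θ / 4) - 1 / 2) with hs
    have hs0 : 0 ≤ s := Real.rpow_nonneg hβ0.le _
    have hs1 : s ≤ 1 := Real.rpow_le_one_of_one_le_of_nonpos (by linarith) (by linarith)
    -- the even quartic slot
    have mW : ∀ z : Site 4, Measurable fun a : LandauFree H → E3 => chartPlaqCost H z 1 2 a - linCurvSq H (plaq12At z) a - chartPlaqCostOdd H z 1 2 a :=
      fun z => ((EdgeChartGaussian.measurable_chartPlaqCost H z 1 2).sub (EdgeChartGaussian.measurable_linCurvSq H (plaq12At z))).sub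
        (EdgeChartGaussian.measurable_chartPlaqCostOdd H z 1 2)
    have bW : ∀ z : Site 4, ∀ a ∈ D, |chartPlaqCost H z 1 2 a - linCurvSq H (plaq12At z) a - chartPlaqCostOdd H z 1 2 a| ≤ C₇ * s ^ 4 := by
      intro z a ha
      have h := (h7c H z s a hs0 hs1 fun i => TiltSup.norm_plaqVar_le hs0 (hDs ha) z 1 2 i).1
      rw [← WilsonSandwich.linCurvSq_eq_norm_sq H a z 1 2] at h
      exact h
    have hν : 0 ≤ C₇ * s ^ 4 := mul_nonneg hC₇ (pow_nonneg hs0 4)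
    -- the odd slot
    have mO : ∀ z : Site 4, Measurable (chartPlaqCostOdd H z 1 2) := fun z => EdgeChartGaussian.measurable_chartPlaqCostOdd H z 1 2
    have bO : ∀ z : Site 4, ∀ a ∈ D, |chartPlaqCostOdd H z 1 2 a| ≤ 4 := fun z a _ => EdgeChartGaussian.abs_chartPlaqCostOdd_le H z 1 2 a
    have iO : ∀ z : Site 4, Integrable fun a : LandauFree H → E3 => (chartPlaqCostOdd H z 1 2 a - 0) ^ 2 * gaussWeight β H a := by
      intro z
      simp only [sub_zero]
      exact Tilt.integrable_bdd_mul_gaussWeight H hβ0 ((mO z).pow_const 2) (C := 4 ^ 2) fun a => by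
        rw [abs_pow]; exact pow_le_pow_left₀ (abs_nonneg _) (EdgeChartGaussian.abs_chartPlaqCostOdd_le H z 1 2 a) 2
    have hA : ∀ z : Site 4, gaussAvg β H (fun a => (chartPlaqCostOdd H z 1 2 a - 0) ^ 2) ≤ C₁₂ / β ^ 3 := by
      intro z
      simp only [sub_zero]
      exact PlaqObsL2.gaussAvg_chartPlaqCostOdd_sq_le H z 1 2 hβ0
    -- the two terms
    have h1 := (hcore H hH β hβ0 B Tc hTc s hs0 D hDm hDs _ hco hτ2 _ _ (mW y) (mO x) _ _ _ _ hν (bW y) (bO x) (iO x) (hA x)).2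
    have h2 := (hcore H hH β hβ0 B Tc hTc s hs0 D hDm hDs _ hco hτ2 _ _ (mW x) (mO y) _ _ _ _ hν (bW x) (bO y) (iO y) (hA y)).1
    -- the square roots in letters
    have hsP : Real.sqrt (2 * (CT * B ^ 2 * (H : ℝ) ^ 4 * (1 + Real.log H) ^ 3 / β)) ≤
        Real.sqrt (2 * CT) * B * (H : ℝ) ^ 2 * (1 + Real.log H) ^ 2 * Real.sqrt β⁻¹ := by
      have hK0 : 0 ≤ Real.sqrt (2 * CT) * B * (H : ℝ) ^ 2 * (1 + Real.log H) ^ 2 * Real.sqrt β⁻¹ := by positivity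
      refine (Real.sqrt_le_sqrt ?_).trans (le_of_eq (Real.sqrt_sq hK0))
      have e : (Real.sqrt (2 * CT) * B * (H : ℝ) ^ 2 * (1 + Real.log H) ^ 2 * Real.sqrt β⁻¹) ^ 2 =
          2 * CT * B ^ 2 * (H : ℝ) ^ 4 * (1 + Real.log H) ^ 4 * β⁻¹ := by
        rw [show (Real.sqrt (2 * CT) * B * (H : ℝ) ^ 2 * (1 + Real.log H) ^ 2 * Real.sqrt β⁻¹) ^ 2 =
            Real.sqrt (2 * CT) ^ 2 * (B ^ 2 * ((H : ℝ) ^ 2) ^ 2 * ((1 + Real.log H) ^ 2) ^ 2) * Real.sqrt β⁻¹ ^ 2 by ring,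
          Real.sq_sqrt (by positivity), Real.sq_sqrt (inv_nonneg.2 hβ0.le)]
        ring
      rw [e, div_eq_mul_inv]
      have hL34 : (1 + Real.log (H : ℝ)) ^ 3 ≤ (1 + Real.log (H : ℝ)) ^ 4 := pow_le_pow_right₀ hL1 (by norm_num)
      have hc : 0 ≤ 2 * CT * B ^ 2 * (H : ℝ) ^ 4 * β⁻¹ := by positivity
      nlinarith [mul_le_mul_of_nonneg_left hL34 hc]
    have hsO : Real.sqrt (2 * (C₁₂ / β ^ 3)) ≤ Real.sqrt (2 * C₁₂) * (β⁻¹ * Real.sqrt β⁻¹) := by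
      have hK0 : 0 ≤ Real.sqrt (2 * C₁₂) * (β⁻¹ * Real.sqrt β⁻¹) := by positivity
      refine (Real.sqrt_le_sqrt (le_of_eq ?_)).trans (le_of_eq (Real.sqrt_sq hK0))
      rw [show (Real.sqrt (2 * C₁₂) * (β⁻¹ * Real.sqrt β⁻¹)) ^ 2 = Real.sqrt (2 * C₁₂) ^ 2 * (β⁻¹ ^ 2 * Real.sqrt β⁻¹ ^ 2) by ring,
        Real.sq_sqrt (by positivity), Real.sq_sqrt (inv_nonneg.2 hβ0.le), div_eq_mul_inv, ← inv_pow]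
      ring
    have hprod : Real.sqrt (2 * (CT * B ^ 2 * (H : ℝ) ^ 4 * (1 + Real.log H) ^ 3 / β)) * Real.sqrt (2 * (C₁₂ / β ^ 3)) ≤
        (Real.sqrt (2 * CT) * B * (H : ℝ) ^ 2 * (1 + Real.log H) ^ 2 * Real.sqrt β⁻¹) * (Real.sqrt (2 * C₁₂) * (β⁻¹ * Real.sqrt β⁻¹)) :=
      mul_le_mul hsP hsO (Real.sqrt_nonneg _) (by positivity)
    have hM := mul_le_mul_of_nonneg_left hprod (by positivity : (0 : ℝ) ≤ 2 * (C₇ * s ^ 4))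
    have hss : Real.sqrt β⁻¹ * Real.sqrt β⁻¹ = β⁻¹ := Real.mul_self_sqrt (inv_nonneg.2 hβ0.le)
    have e : 2 * (2 * (C₇ * s ^ 4) * ((Real.sqrt (2 * CT) * B * (H : ℝ) ^ 2 * (1 + Real.log H) ^ 2 * Real.sqrt β⁻¹) *
        (Real.sqrt (2 * C₁₂) * (β⁻¹ * Real.sqrt β⁻¹)))) =
        4 * Real.sqrt (2 * CT) * Real.sqrt (2 * C₁₂) * C₇ * B * (H : ℝ) ^ 2 * (1 + Real.log H) ^ 2 * s ^ 4 * (β⁻¹ * (Real.sqrt β⁻¹ * Real.sqrt β⁻¹)) := by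
      ring
    rw [hss, ← pow_two] at e
    refine (abs_add_le _ _).trans ?_
    beta_reduce
    rw [← hs, ← e]
    linarith [h1, h2, hM]
  · intro ε hε
    have hcond : ((10 : ℕ) : ℝ) * θ + 0 < ((4 : ℕ) : ℝ) * (1 / 2 - (1 / 8 - θ / 4)) := by push_cast; linarith
    obtain ⟨β₀, hβ₀, h⟩ := budget_monomial (a := 0) (k := 10) (j := 4) (κ₃ := 1 / 8 - θ / 4) hθ.le hcond hε
      (4 * Real.sqrt (2 * CT) * Real.sqrt (2 * C₁₂) * C₇ * B) 2
    refine ⟨β₀, hβ₀, fun β hβ H hH hHu => ?_⟩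
    have hβ0 : 0 < β := by linarith
    have e := h β hβ H hH hHu
    rw [Real.rpow_zero, mul_one] at e
    have hb : β ^ 2 * β⁻¹ ^ 2 = 1 := by rw [← mul_pow, mul_inv_cancel₀ hβ0.ne', one_pow]
    have hid : β ^ 2 * (H : ℝ) ^ 8 * (4 * Real.sqrt (2 * CT) * Real.sqrt (2 * C₁₂) * C₇ * B * (H : ℝ) ^ 2 * (1 + Real.log H) ^ 2 *
        (β ^ ((1 / 8 - θ / 4) - 1 / 2)) ^ 4 * β⁻¹ ^ 2) =
        4 * Real.sqrt (2 * CT) * Real.sqrt (2 * C₁₂) * C₇ * B * (H : ℝ) ^ 10 * (1 + Real.log H) ^ 2 *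
          (β ^ (1 / 8 - θ / 4 - 1 / 2)) ^ 4 * (β ^ 2 * β⁻¹ ^ 2) := by ring
    rw [hid, hb, mul_one]
    exact e


end K3RowSum

end Summit.QuantumFields.YangMills.Theorems.AllWindowsColdBoxBoxHighLine

end
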